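import Literature.AnabelianGeometry.EtaleTheta.GalSectCuspPairTorsors
import HarnessLib

/-!
# [GalSect] §4: a torsor structure on the splitting classes at a cusp ⇔ a trivialisation (non-vacuity of `TorsorData`)

S. Mochizuki, *Galois sections in absolute anabelian geometry* [GalSect], Nagoya Math. J. **179** (2005),
§4 p.33: "the splittings of `1 → I_x → D_x → G_K → 1` … form a torsor over `H¹(G_K, Ẑ(1)) ≅ (K^×)^∧`"
[cite: MochizukiGalSect2005, §4 p.33]; consumed by [EtTh] Cor. 2.8 (ii) p.268 (PRIMS PDF p.42)
[cite: MochizukiEtTh2009, Cor 2.8 (ii) p.42] through abc-iut-w5-d062's interface records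
`GalSect.CuspPair.TorsorData` (abstract cuspidal pair `(D, I)`, abstract structure group `A`;
`GalSectCuspPairTorsors.lean`) and `GalSect.CuspidalTorsorData` (the pair `(D_x, I_x)` of a tempered curve,
structure group the REAL `(K^×)^∧ = KxHat X`; `GalSectCuspidalTorsors.lean`).

NON-VACUITY (cell abc-iut §4(iii); NV-L2 rows `GalSect.CuspPair.TorsorData`, `GalSect.CuspidalTorsorData`,
ZERO producers in the L2 inhabitation census v2b, abc-iut-w5-d029 2026-08-26T05:34Z).  PROOF-ONLY
consequences of the two records AS TYPED (a free transitive action = `act_one`, `act_mul`,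
`existsUnique_act_eq`), with no hypothesis on the curve:

* `TorsorData.ofEquiv` / `CuspidalTorsorData.ofEquiv` — a TRIVIALISATION `e : SplittingClass ≃ A` yields a
  torsor structure (`a · c := e⁻¹ (a · e c)`, left translation transported);
* `TorsorData.equivOfPoint` / `CuspidalTorsorData.equivOfPoint` — conversely a torsor structure together
  with ONE splitting class `c₀` yields the trivialisation `c ↦ (the unique a with a · c₀ = c)` ("a torsor
  with a point is trivial");
* hence `nonempty_torsorData_iff` / `nonempty_cuspidalTorsorData_iff`: when a splitting class exists, the
  record is inhabited iff the class set is equinumerous with the structure group; and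
  `TorsorData.ofIsEmpty`: with NO splitting class every group acts (vacuously) simply transitively.

READING (honest): the typed records therefore carry exactly "some simply transitive action"; WHICH action
— the one induced by `H¹(G_K, Ẑ(1))` on sections, [GalSect] §4 — is the content of the origin predicate
`CuspidalTorsorOrigin.IsTorsorOrigin` (`GalSectIntegralStructures.lean`), untouched here.  Post-freeze
class (b) construction/proof file of the L2 DEFS-FREEZE (05:00Z): new file, no field added to a frozen
structure, no instance, no Prop fact.  [GalSect] and [EtTh] are refereed; typed ≠ proved; no side taken
on [IUTchIII] Cor. 3.12.
-/

noncomputable section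

namespace Literature.AnabelianGeometry.EtaleTheta

namespace GalSect

/-! ### A. Abstract cuspidal pair `(D, I)`, abstract structure group `A` -/

namespace CuspPair.TorsorData

variable {G : Type*} [Group G] [TopologicalSpace G] {P : CuspPair G} {A : Type*} [Group A]

/-- **A trivialisation gives a torsor structure**: along `e : SplittingClass ≃ A`, let `A` act by left
translation, `a · c := e⁻¹ (a · e c)` — free and transitive. [cite: MochizukiGalSect2005, §4 p.33] -/
def ofEquiv (e : P.SplittingClass ≃ A) : P.TorsorData A where
  act a c := e.symm (a * e c)
  act_one c := by simp
  act_mul a b c := by simp [mul_assoc]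
  existsUnique_act_eq c c' := by
    refine ⟨e c' * (e c)⁻¹, by simp, fun a ha => ?_⟩
    have h : a * e c = e c' := by simpa using congrArg e ha
    rw [← h, mul_inv_cancel_right]

/-- The action of `ofEquiv e` (definitional unfolding). [cite: MochizukiGalSect2005, §4 p.33] -/
@[simp] theorem ofEquiv_act (e : P.SplittingClass ≃ A) (a : A) (c : P.SplittingClass) :
    (ofEquiv e).act a c = e.symm (a * e c) := rfl

/-- **A torsor with a point is trivial**: for a torsor structure `T` and a splitting class `c₀`, the map
`c ↦ (the unique a ∈ A with a · c₀ = c)` is a bijection `SplittingClass ≃ A` with inverse `a ↦ a · c₀`.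
[cite: MochizukiGalSect2005, §4 p.33] -/
def equivOfPoint (T : P.TorsorData A) (c₀ : P.SplittingClass) : P.SplittingClass ≃ A where
  toFun c := (T.existsUnique_act_eq c₀ c).choose
  invFun a := T.act a c₀
  left_inv c := (T.existsUnique_act_eq c₀ c).choose_spec.1
  right_inv a := (T.existsUnique_act_eq c₀ (T.act a c₀)).unique
    (T.existsUnique_act_eq c₀ (T.act a c₀)).choose_spec.1 rfl

/-- The inverse trivialisation is the orbit map of `c₀`. [cite: MochizukiGalSect2005, §4 p.33] -/
@[simp] theorem equivOfPoint_symm_apply (T : P.TorsorData A) (c₀ : P.SplittingClass) (a : A) :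
    (equivOfPoint T c₀).symm a = T.act a c₀ := rfl

/-- `(equivOfPoint T c₀ c) · c₀ = c`. [cite: MochizukiGalSect2005, §4 p.33] -/
@[simp] theorem act_equivOfPoint (T : P.TorsorData A) (c₀ c : P.SplittingClass) :
    T.act (equivOfPoint T c₀ c) c₀ = c :=
  (T.existsUnique_act_eq c₀ c).choose_spec.1

/-- The base point trivialises to `1`. [cite: MochizukiGalSect2005, §4 p.33] -/
@[simp] theorem equivOfPoint_self (T : P.TorsorData A) (c₀ : P.SplittingClass) :
    equivOfPoint T c₀ c₀ = 1 :=
  (T.existsUnique_act_eq c₀ c₀).unique (act_equivOfPoint T c₀ c₀) (T.act_one c₀)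

/-- With NO splitting class every group acts simply transitively (vacuously): the record is inhabited
whatever `A` is. [cite: MochizukiGalSect2005, §4 p.33] -/
def ofIsEmpty [IsEmpty P.SplittingClass] : P.TorsorData A where
  act _ c := c
  act_one _ := rfl
  act_mul _ _ _ := rfl
  existsUnique_act_eq c := isEmptyElim c

/-- **Non-vacuity criterion for `TorsorData`**: as soon as a splitting class exists, an `A`-torsor
structure on the splitting classes exists iff the classes are equinumerous with `A`.
[cite: MochizukiGalSect2005, §4 p.33] -/
theorem nonempty_iff (h : Nonempty P.SplittingClass) :
    Nonempty (P.TorsorData A) ↔ Nonempty (P.SplittingClass ≃ A) :=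
  ⟨fun ⟨T⟩ => ⟨equivOfPoint T h.some⟩, fun ⟨e⟩ => ⟨ofEquiv e⟩⟩

/-- Unconditionally: a trivialisation suffices. [cite: MochizukiGalSect2005, §4 p.33] -/
theorem nonempty_of_equiv (e : P.SplittingClass ≃ A) : Nonempty (P.TorsorData A) := ⟨ofEquiv e⟩

/-- In particular the splitting classes ALWAYS carry a torsor structure under some group: the
permutation group is too big in general, but `A := Multiplicative ℤ`-many is not needed — take for `A`
any group equinumerous with the classes; the cheapest closed instance is the class set of a pair with at
most one class under the trivial group. Recorded as: a pair whose classes form a subsingleton carries a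
`Unit`-torsor structure as soon as one class exists. [cite: MochizukiGalSect2005, §4 p.33] -/
theorem nonempty_unit_of_subsingleton [Subsingleton P.SplittingClass] (c₀ : P.SplittingClass) :
    Nonempty (P.TorsorData Unit) :=
  nonempty_of_equiv
    { toFun := fun _ => (), invFun := fun _ => c₀, left_inv := fun c => Subsingleton.elim _ c,
      right_inv := fun _ => rfl }

end CuspPair.TorsorData

/-! ### B. The pair `(D_x, I_x)` of a tempered curve, structure group the real `(K^×)^∧` -/

namespace CuspidalTorsorData

variable {p : ℕ} [Fact p.Prime] {X : Literature.AnabelianGeometry.SemiGraphs.TemperedCurve p} {x : X.Pt}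

/-- **A trivialisation `SplittingClass X x ≃ (K^×)^∧` gives a `(K^×)^∧`-torsor structure at `x`** (left
translation transported). [cite: MochizukiGalSect2005, §4 p.33] -/
def ofEquiv (e : SplittingClass X x ≃ KxHat X) : CuspidalTorsorData X x where
  act k c := e.symm (k * e c)
  act_one c := by simp
  act_mul k k' c := by simp [mul_assoc]
  existsUnique_act_eq c c' := by
    refine ⟨e c' * (e c)⁻¹, by simp, fun k hk => ?_⟩
    have h : k * e c = e c' := by simpa using congrArg e hk
    rw [← h, mul_inv_cancel_right]

/-- The action of `ofEquiv e`. [cite: MochizukiGalSect2005, §4 p.33] -/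
@[simp] theorem ofEquiv_act (e : SplittingClass X x ≃ KxHat X) (k : KxHat X) (c : SplittingClass X x) :
    (ofEquiv e).act k c = e.symm (k * e c) := rfl

/-- **A `(K^×)^∧`-torsor structure with a chosen class `c₀` trivialises the class set**:
`c ↦ (the unique k with k · c₀ = c)`. [cite: MochizukiGalSect2005, §4 p.33] -/
def equivOfPoint (T : CuspidalTorsorData X x) (c₀ : SplittingClass X x) : SplittingClass X x ≃ KxHat X where
  toFun c := (T.existsUnique_act_eq c₀ c).choose
  invFun k := T.act k c₀
  left_inv c := (T.existsUnique_act_eq c₀ c).choose_spec.1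
  right_inv k := (T.existsUnique_act_eq c₀ (T.act k c₀)).unique
    (T.existsUnique_act_eq c₀ (T.act k c₀)).choose_spec.1 rfl

/-- The inverse trivialisation is the orbit map. [cite: MochizukiGalSect2005, §4 p.33] -/
@[simp] theorem equivOfPoint_symm_apply (T : CuspidalTorsorData X x) (c₀ : SplittingClass X x)
    (k : KxHat X) : (equivOfPoint T c₀).symm k = T.act k c₀ := rfl

/-- `(equivOfPoint T c₀ c) · c₀ = c`. [cite: MochizukiGalSect2005, §4 p.33] -/
@[simp] theorem act_equivOfPoint (T : CuspidalTorsorData X x) (c₀ c : SplittingClass X x) :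
    T.act (equivOfPoint T c₀ c) c₀ = c :=
  (T.existsUnique_act_eq c₀ c).choose_spec.1

/-- The base point trivialises to `1 ∈ (K^×)^∧`. [cite: MochizukiGalSect2005, §4 p.33] -/
@[simp] theorem equivOfPoint_self (T : CuspidalTorsorData X x) (c₀ : SplittingClass X x) :
    equivOfPoint T c₀ c₀ = 1 :=
  (T.existsUnique_act_eq c₀ c₀).unique (act_equivOfPoint T c₀ c₀) (T.act_one c₀)

/-- With no splitting class at `x` the record is inhabited vacuously. [cite: MochizukiGalSect2005, §4 p.33] -/
def ofIsEmpty [IsEmpty (SplittingClass X x)] : CuspidalTorsorData X x where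
  act _ c := c
  act_one _ := rfl
  act_mul _ _ _ := rfl
  existsUnique_act_eq c := isEmptyElim c

/-- **Non-vacuity criterion for `CuspidalTorsorData X x`**: once a splitting class at `x` exists, a
`(K^×)^∧`-torsor structure exists iff `SplittingClass X x ≃ (K^×)^∧`; which of these structures is "the"
torsor of [GalSect] §4 is the origin predicate `CuspidalTorsorOrigin.IsTorsorOrigin`, not decided by the
record. [cite: MochizukiGalSect2005, §4 p.33] -/
theorem nonempty_iff (h : Nonempty (SplittingClass X x)) :
    Nonempty (CuspidalTorsorData X x) ↔ Nonempty (SplittingClass X x ≃ KxHat X) :=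
  ⟨fun ⟨T⟩ => ⟨equivOfPoint T h.some⟩, fun ⟨e⟩ => ⟨ofEquiv e⟩⟩

/-- Unconditionally: a trivialisation suffices. [cite: MochizukiGalSect2005, §4 p.33] -/
theorem nonempty_of_equiv (e : SplittingClass X x ≃ KxHat X) : Nonempty (CuspidalTorsorData X x) :=
  ⟨ofEquiv e⟩

/-- Two torsor structures at `x` sharing a base class differ by a BIJECTION of `(K^×)^∧` fixing `1`
(composite of the two trivialisations) — the typed record pins the action only up to such re-gaugings.
[cite: MochizukiGalSect2005, §4 p.33] -/
theorem equivOfPoint_trans_symm_one (T T' : CuspidalTorsorData X x) (c₀ : SplittingClass X x) :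
    ((equivOfPoint T c₀).symm.trans (equivOfPoint T' c₀)) 1 = 1 := by
  simp [T.act_one]

end CuspidalTorsorData

end GalSect

end Literature.AnabelianGeometry.EtaleTheta

end
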